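import Summits.RiemannHypothesis.RiemannHypothesis.Theorems.TiltedLandingLaw421R3LandingDoor

/-! # LENS-1 · the JENSEN DIP LEMMA (real-axis dual of Jensen's circle theorem) and the DEEP-DIP successor (rh33346-lens-1-g2)

Classical fact (Jensen 1913 / Pólya; the real-axis companion of the tree's PROVED `Literature.Analysis.Complex.jensen_circle`):
for a real point `x` OUTSIDE every open Jensen disc of an entire `g` of order `< 2`, `(g′/g)′(x) = −Σ m(a) Re (x − a)⁻² + o(1) ≤ 0`,
because a zero `a = α + iβ` contributes `−m(a)·((x−α)² − β²)/|x−a|⁴ ≤ 0` exactly when `|x − α| ≥ β`.  Read contrapositively: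

**JENSEN DIP LEMMA** (`jensenDip`): if `g(x) ≠ 0`, `g′(x) = 0` and `Re (g″(x)/g(x)) > 0` — a NON-CROSSING DIP of `|g|` on the axis — then
`x` lies in the open Jensen disc of some zero `a` of `g`: `|x − Re a| < |Im a|` (in particular `g` HAS a non-real zero, in the 45° cone over `x`).
No reality of `g` is needed; the proof is Titchmarsh's Lemma α at centre `x` (`Literature.Analysis.Complex.titchmarsh_logDeriv_sub_sum`),
differentiated once, with the error `64(log M_R/|g(x)| + 1)/R² → 0` (`Literature.Analysis.Complex.tendsto_growth_div_sq`).

**DEEP-DIP SUCCESSOR** (`succ_of_landingDip_deep`): in the frame `EngineHyps5 2 …`, a landing dip of `f^{(j+1)}` at `xs` (the lens-1 cell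
datum `LandingDip`: `f^{(j+2)}(xs) = 0`, `f^{(j+1)}(xs)·f^{(j+3)}(xs) > 0`) with `|xs − x₀| + Hs ≤ R/2` yields a successor
`∃ u, StTrkDQ … (j+1) u`: the cone zero `a` of `f^{(j+1)}` has `0 < |Im a| ≤ Hs` (strip heredity `analyticHeredity_landed`) and
`|Re a − x₀| < |xs − x₀| + |Im a| ≤ R/2`, so `a` (or `ā`) is in the level-`(j+1)` band-quadratic window.  This DISCHARGES the deep part of
the coverage cell «L» of `Lens1_Coverage.lean` in successor currency, by a SIGN argument — no Rouché circle, no margin.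
Nothing here bears on the truth of RH; RH is not proved; 33346/33347 OPEN. -/

namespace Summit.RiemannHypothesis.RiemannHypothesis.Cruxes.TiltedLandingLaw421R.Lens1

set_option linter.dupNamespace false

open Complex Set Filter Metric Topology
open scoped ComplexConjugate
open Literature.Analysis.Complex
open RhIdea6.G17.W07C7 RhIdea6.G17.W07C7.Rev6 RhIdea6.G18.W07C8.Law421BirthS RhIdea6.G19.W07C11.Seam
open RhIdea6.G20.W07C12.Frac RhIdea6.G20.W07C12.StColP RhW07.C12.FieldSplit RhIdea6.G21.W07C13.TentMax
open RhW07.C14.TwoSided RhW07.C14.Classes RhW07.C14.Lineage RhW07.C14.Booking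
open RhW07.C13.Heredity RhIdea6.G22.W07C15pre.Injection RhW07.E3.Cell RhW07.E3.Lit
open RhW08.Round1 RhW08.StSwap RhW08.Round2 RhW08.QuadW RhW08.SealSwapQ RhW08.SealSwap RhW08.SuccB RhW08.SuccSplit

/-! ## §1 Algebra of one pole term -/

/-- `Re (w²)⁻¹ < 0 ⟹ |Re w| < |Im w|` (the 45° cone). -/
theorem abs_re_lt_abs_im_of_re_inv_sq_neg {w : ℂ} (h : ((w ^ 2)⁻¹).re < 0) : |w.re| < |w.im| := by
  rw [Complex.inv_re] at h
  have hns : 0 ≤ Complex.normSq (w ^ 2) := Complex.normSq_nonneg _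
  have hre : (w ^ 2).re = w.re ^ 2 - w.im ^ 2 := by
    rw [sq, Complex.mul_re]; ring
  have hneg : (w ^ 2).re < 0 := by
    by_contra hcon
    push Not at hcon
    have : 0 ≤ (w ^ 2).re / Complex.normSq (w ^ 2) := div_nonneg hcon hns
    linarith
  rw [hre] at hneg
  exact sq_lt_sq.1 (by linarith)

/-- The pole term `m/(z − a)` has derivative `−m/(x − a)²` at `x ≠ a`. -/
theorem hasDerivAt_poleTerm (m : ℂ) {x a : ℂ} (hxa : x ≠ a) :
    HasDerivAt (fun z : ℂ => m / (z - a)) (-(m / (x - a) ^ 2)) x := by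
  have hsub : HasDerivAt (fun z : ℂ => z - a) 1 x := (hasDerivAt_id x).sub_const a
  have hne : x - a ≠ 0 := sub_ne_zero.2 hxa
  have hinv := hsub.inv hne
  have h := hinv.const_mul m
  have e : (fun z : ℂ => m / (z - a)) = fun z => m * (z - a)⁻¹ := by
    funext z; rw [div_eq_mul_inv]
  rw [e]
  refine h.congr_deriv ?_
  field_simp

/-! ## §2 The Jensen dip lemma -/

/-- **JENSEN DIP LEMMA.**  `g` entire with `‖g z‖ ≤ C e^{‖z‖^ρ}` (`0 ≤ ρ < 2`); at a real point `x` with `g x ≠ 0`, `g′ x = 0` and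
`0 < Re (g″ x / g x)` there is a zero `a` of `g` whose open Jensen disc contains `x`: `|x − Re a| < |Im a|`.
[Jensen 1913 / Pólya: the real-axis sign of `(g′/g)′` off the Jensen discs; proof via Titchmarsh1986 §3.9 Lemma α] -/
theorem jensenDip {g : ℂ → ℂ} (hg : Differentiable ℂ g) {ρ C : ℝ} (hρ0 : 0 ≤ ρ) (hρ : ρ < 2)
    (hgr : ∀ z, ‖g z‖ ≤ C * Real.exp (‖z‖ ^ ρ)) {x : ℝ} (hx : g x ≠ 0) (hx1 : deriv g x = 0)
    (hx2 : 0 < (deriv (deriv g) x / g x).re) :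
    ∃ a : ℂ, g a = 0 ∧ |x - a.re| < |a.im| := by
  classical
  have hCpos : 0 < C := growthConst_pos hgr hx
  have hgx : 0 < ‖g (x : ℂ)‖ := norm_pos_iff.2 hx
  set δ : ℝ := (deriv (deriv g) x / g x).re with hδ
  set K : ℝ := Real.log C - Real.log ‖g (x : ℂ)‖ + 1 with hK
  -- choose `R` with the Titchmarsh error below `δ`
  have hlim : Tendsto (fun R : ℝ ↦ 64 * ((K + (|x| + 2 * R) ^ ρ) / R ^ 2)) atTop (𝓝 0) := by
    simpa using (tendsto_growth_div_sq K x hρ0 hρ).const_mul 64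
  obtain ⟨R, hRδ, hRge⟩ := ((hlim.eventually_lt_const hx2).and (eventually_ge_atTop (1 : ℝ))).exists
  have hRpos : 0 < R := by linarith
  set M : ℝ := C * Real.exp ((|x| + 2 * R) ^ ρ) with hM
  obtain ⟨S, m, ψ, hS, hS', hψd, hψeq, -, hψ'⟩ :=
    titchmarsh_logDeriv_sub_sum hg hx hRpos (norm_le_on_closedBall hρ0 hgr x R)
  have hlog : Real.log (M / ‖g (x : ℂ)‖) + 1 = K + (|x| + 2 * R) ^ ρ := by
    rw [hK, hM, Real.log_div (by positivity) hgx.ne', Real.log_mul hCpos.ne' (Real.exp_pos _).ne',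
      Real.log_exp]
    ring
  -- `x ∉ S` (no zero at `x`)
  have hxS : ∀ a ∈ S, (x : ℂ) ≠ a := by
    intro a ha hxa; exact hx (by rw [hxa]; exact (hS a ha).1)
  -- the identity `g′/g = Σ m/(z − a) + ψ` holds on a neighbourhood of `x`
  have hball : ball (x : ℂ) R ∈ 𝓝 (x : ℂ) := isOpen_ball.mem_nhds (mem_ball_self hRpos)
  have hne_nhds : ∀ᶠ z in 𝓝 (x : ℂ), g z ≠ 0 :=
    (hg.continuous.continuousAt (x := (x : ℂ))).eventually_ne hx
  have hEq : (fun z => deriv g z / g z) =ᶠ[𝓝 (x : ℂ)] fun z => (∑ a ∈ S, (m a : ℂ) / (z - a)) + ψ z := by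
    filter_upwards [hball, hne_nhds] with z hz hz0
    rw [hψeq z hz hz0]; ring
  -- derivative of the left side at `x`
  have hdg : Differentiable ℂ (deriv g) := by
    have := differentiable_iteratedDeriv_of_entire hg 1
    simpa [iteratedDeriv_one] using this
  have hL : HasDerivAt (fun z => deriv g z / g z) (deriv (deriv g) x / g x) x := by
    have h : HasDerivAt (fun z => deriv g z / g z)
        ((deriv (deriv g) x * g x - deriv g x * deriv g x) / g x ^ 2) x :=
      (hdg.differentiableAt.hasDerivAt (x := (x : ℂ))).div (hg.differentiableAt.hasDerivAt) hx
    refine h.congr_deriv ?_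
    rw [hx1]; field_simp; ring
  -- derivative of the right side at `x`
  have hR : HasDerivAt (fun z => (∑ a ∈ S, (m a : ℂ) / (z - a)) + ψ z)
      ((∑ a ∈ S, -((m a : ℂ) / (x - a) ^ 2)) + deriv ψ x) x := by
    have hsum : HasDerivAt (fun z => ∑ a ∈ S, (m a : ℂ) / (z - a)) (∑ a ∈ S, -((m a : ℂ) / (x - a) ^ 2)) x := by
      have h := HasDerivAt.sum (fun a ha => hasDerivAt_poleTerm (m a : ℂ) (hxS a ha))
      rwa [Finset.sum_fn] at h
    have hψx : HasDerivAt ψ (deriv ψ x) x :=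
      (hψd.differentiableAt hball).hasDerivAt
    exact hsum.add hψx
  -- the two derivatives agree
  have hderiv_eq : deriv (deriv g) x / g x = (∑ a ∈ S, -((m a : ℂ) / (x - a) ^ 2)) + deriv ψ x := by
    have h1 := hL.deriv
    have h2 : deriv (fun z => deriv g z / g z) x = (∑ a ∈ S, -((m a : ℂ) / (x - a) ^ 2)) + deriv ψ x := by
      rw [hEq.deriv_eq]; exact hR.deriv
    rw [← h1, h2]
  -- real parts: if every pole term had `Re (x − a)⁻² ≥ 0` we would get `δ ≤ ‖ψ′ x‖ < δ`
  by_contra hcone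
  push Not at hcone
  have hterm : ∀ a ∈ S, 0 ≤ ((m a : ℂ) / ((x : ℂ) - a) ^ 2).re := by
    intro a ha
    have hma : ((m a : ℂ) / ((x : ℂ) - a) ^ 2) = (m a : ℝ) * (((x : ℂ) - a) ^ 2)⁻¹ := by
      rw [div_eq_mul_inv]; norm_cast
    rw [hma, Complex.re_ofReal_mul]
    apply mul_nonneg (Nat.cast_nonneg _)
    by_contra hneg
    push Not at hneg
    have hc := abs_re_lt_abs_im_of_re_inv_sq_neg hneg
    have : |x - a.re| < |a.im| := by simpa using hc
    exact absurd this (not_lt.2 (hcone a (hS a ha).1))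
  have hre : δ = (∑ a ∈ S, -((m a : ℂ) / (x - a) ^ 2)).re + (deriv ψ x).re := by
    rw [hδ, hderiv_eq, Complex.add_re]
  rw [Complex.re_sum] at hre
  have hsum_nonpos : ∑ a ∈ S, (-((m a : ℂ) / ((x : ℂ) - a) ^ 2)).re ≤ 0 := by
    apply Finset.sum_nonpos
    intro a ha
    rw [Complex.neg_re]
    linarith [hterm a ha]
  have hψre : (deriv ψ x).re ≤ 64 * ((K + (|x| + 2 * R) ^ ρ) / R ^ 2) := by
    have hxin : (x : ℂ) ∈ closedBall (x : ℂ) (R / 8) := mem_closedBall_self (by linarith)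
    calc (deriv ψ x).re ≤ ‖deriv ψ x‖ := Complex.re_le_norm _
      _ ≤ 64 * (Real.log (M / ‖g (x : ℂ)‖) + 1) / R ^ 2 := hψ' _ hxin
      _ = 64 * ((K + (|x| + 2 * R) ^ ρ) / R ^ 2) := by rw [hlog]; ring
  have : δ < δ := by
    calc δ = _ := hre
      _ ≤ 0 + 64 * ((K + (|x| + 2 * R) ^ ρ) / R ^ 2) := add_le_add hsum_nonpos hψre
      _ < δ := by rw [zero_add]; exact hRδ
  exact lt_irrefl _ this

/-- The Jensen dip lemma for a REAL entire `g`: the cone zero may be taken in the UPPER half-plane. -/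
theorem jensenDip_pos {g : ℂ → ℂ} (hg : Differentiable ℂ g) {ρ C : ℝ} (hρ0 : 0 ≤ ρ) (hρ : ρ < 2)
    (hgr : ∀ z, ‖g z‖ ≤ C * Real.exp (‖z‖ ^ ρ)) (hreal : ∀ t : ℝ, (g t).im = 0) {x : ℝ} (hx : g x ≠ 0)
    (hx1 : deriv g x = 0) (hx2 : 0 < (deriv (deriv g) x / g x).re) :
    ∃ a : ℂ, g a = 0 ∧ 0 < a.im ∧ |x - a.re| < a.im := by
  obtain ⟨a, ha, hcone⟩ := jensenDip hg hρ0 hρ hgr hx hx1 hx2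
  have him : a.im ≠ 0 := by
    intro h0; rw [h0, abs_zero] at hcone; exact absurd hcone (not_lt.2 (abs_nonneg (x - a.re)))
  rcases lt_or_gt_of_ne him with hneg | hpos
  · refine ⟨conj a, ?_, by simpa using hneg, ?_⟩
    · rw [apply_conj_eq_conj hg hreal a, ha, map_zero]
    · simpa [abs_of_neg hneg] using hcone
  · exact ⟨a, ha, hpos, by simpa [abs_of_pos hpos] using hcone⟩

/-! ## §3 The deep-dip successor -/

/-- **DEEP-DIP SUCCESSOR.**  In the frame, a non-crossing dip of `f^{(j+1)}` at a real point `xs` with `|xs − x₀| + Hs ≤ R/2` gives a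
successor state at level `j+1`.  (Dip data exactly as in the lens-1 cell datum `LandingDip`, minus its localisation `|xs − Re v| < 2·Im v`.) -/
theorem succ_of_dip_deep {η : ℝ} {f : ℂ → ℂ} {x₀ s hmax R Hs : ℝ} {B j : ℕ}
    (hE : EngineHyps5 2 η f x₀ s hmax R Hs B) {xs m A : ℝ}
    (hm : (m : ℂ) = iteratedDeriv (j + 1) f xs) (h2 : iteratedDeriv (j + 2) f xs = 0)
    (hA : ((2 * A : ℝ) : ℂ) = iteratedDeriv (j + 3) f xs) (hmA : 0 < m * A)
    (hdeep : |xs - x₀| + Hs ≤ R / 2) :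
    ∃ u : ℂ, StTrkDQ η f x₀ s hmax R Hs B (j + 1) u := by
  obtain ⟨hdiff, hreal, hgrowth, hs, hsh, hhR, h3R, hHs, hstrip, hHsR, hpair, hcol, hhalf, hη0, hη1, hrem⟩ := hE
  set g : ℂ → ℂ := iteratedDeriv (j + 1) f with hg_def
  have hgd : Differentiable ℂ g := differentiable_iteratedDeriv_of_entire hdiff (j + 1)
  have hgreal : ∀ t : ℝ, (g t).im = 0 := im_iteratedDeriv_ofReal hdiff hreal (j + 1)
  -- growth of `g` in the tree form
  have hC0 : InClass f Hs := ⟨hdiff, hreal, hgrowth, hstrip⟩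
  have hm0 : m ≠ 0 := by
    intro h0; rw [h0, zero_mul] at hmA; exact lt_irrefl _ hmA
  have hgx : g xs ≠ 0 := by
    rw [← hm]; exact_mod_cast hm0
  have hgne : g ≠ 0 := by
    intro h0; exact hgx (by rw [h0]; rfl)
  have hCj : InClass g Hs := analyticHeredity_landed f Hs (j + 1) hHs hC0 hgne
  obtain ⟨ρ', C', hρ'0, hρ', -, hgr'⟩ := StubAnalyticHeredity.growth_treeForm hgd hCj.2.2.1
  -- dip data for `g`
  have hx1 : deriv g xs = 0 := by
    rw [hg_def, ← iteratedDeriv_succ]; exact h2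
  have hx2 : 0 < (deriv (deriv g) xs / g xs).re := by
    have e : deriv (deriv g) = iteratedDeriv (j + 3) f := by
      rw [hg_def, ← iteratedDeriv_succ, ← iteratedDeriv_succ]
    rw [e, ← hA, ← hm]
    have : (((2 * A : ℝ) : ℂ) / (m : ℂ)).re = 2 * A / m := by
      rw [← Complex.ofReal_div, Complex.ofReal_re]
    rw [this]
    rcases lt_or_gt_of_ne hm0 with hneg | hpos
    · have hA' : A < 0 := by nlinarith
      exact div_pos_of_neg_of_neg (by linarith) hneg
    · have hA' : 0 < A := by nlinarith
      exact div_pos (by linarith) hpos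
  obtain ⟨a, ha, ha0, hcone⟩ := jensenDip_pos hgd hρ'0 hρ' hgr' hgreal hgx hx1 hx2
  -- strip and band
  have haHs : a.im ≤ Hs := by
    have := hCj.2.2.2 a ha
    rwa [abs_of_pos ha0] at this
  have hare : |a.re - x₀| ≤ R / 2 := by
    have h1 : |a.re - x₀| ≤ |xs - a.re| + |xs - x₀| := by
      have := abs_sub_le (a.re) xs x₀
      rw [abs_sub_comm a.re xs] at this
      linarith
    linarith [hcone.le]
  have hmax : max (|a.re - x₀| - R / 2) 0 = 0 := max_eq_right (by linarith)
  have hsq : a.im ^ 2 ≤ Hs ^ 2 := by nlinarith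
  have hmul := mul_le_mul_of_nonneg_left hsq (show (0 : ℝ) ≤ ((j + 1 : ℕ) : ℝ) by positivity)
  have hband : (max (|a.re - x₀| - R / 2) 0) ^ 2 + ((j + 1 : ℕ) : ℝ) * a.im ^ 2 ≤ ((j + 1 : ℕ) : ℝ) * Hs ^ 2 := by
    rw [hmax]; simpa using hmul
  exact ⟨a, hgne, ha, ha0, by simpa using hband, haHs⟩

end Summit.RiemannHypothesis.RiemannHypothesis.Cruxes.TiltedLandingLaw421R.Lens1
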